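import Summits.MatrixMultiplication.OmegaCensus.STPP222PentaOrder72

/-!
# ω-census, STPP pattern `(2,2,2)^6`: a UNIFORM family — `ℤ/n × ℤ/n` admits it for every `n ≥ 25`

HONEST FRAMING (pub-omega census; verbatim): lottery ticket; floor = certified bounds/negative ranges.
Census STRUCTURE bookkeeping (question Q7 of the pub-omega cell; CKSU 2005 Def. 5.1, tree form `IsSTPP`), not progress
on `ω`: a `(2,2,2)^k` family certifies no matrix-multiplication bound of interest, and every `n² ≥ 625` here lies far
above the kernel threshold `N₆ ≤ 136`, so no onset value moves.  The point is a UNIFORM CONSTRUCTION, the `k = 6`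
analogue of the cyclic `(2,2,2)³` theorem `exists_isSTPP_222cube_zmod` (`m ≥ 46`): ONE integer configuration in
`ℤ × ℤ` whose reductions give six simultaneous-TPP triples of 2-subsets of `ℤ/n × ℤ/n` for all `n ≥ 25`.
Pre-registered as P-036 (pub-omega `prereg/P-036.md`, lead g27, 2026-08-26T13:44Z) BEFORE any `n ≥ 21` was searched;
this file is the kernel form of its structural item P-036.3.

THE CONFIGURATION (seat pub-omega-stpp-3 gen 17, 2026-08-26; found by the complete 'half-orbit' search `orbmix.c`
for `n = 11, …, 40` and read off from the stabilised witnesses of `n = 26, …, 34`).  Let `ρ = [[0,−1],[1,−1]] ∈ GL₂(ℤ)`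
(order 3, `ρ(x,y) = (−y, x−y)`) and `K = ⟨−1, ρ⟩ ≅ C₆`.  Two SYMMETRIC base triples of 2-sets
`T₀ = ({±(0,1)}, {±(0,2)}, {±(0,4)})`, `T₁ = ({±(0,1)}, {±(0,3)}, {±(1,10)})`; the family is
`(ρ^i A_j, ρ^i B_j, ρ^i C_j)` for `i = 0,1,2`, `j = 0,1` (the `K`-orbits have three members each because `−T = T`).
Written out: `rot6A`, `rot6B`, `rot6C` below (integer pairs).

PROOF.  (1) Over `ℤ × ℤ` the configuration satisfies CKSU Def. 5.1 (`stppCheck`, kernel evaluation, 13 824 words) and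
EVERY constraint expression `(s′−s)+(t′−t)+(u′−u)` has both coordinates of absolute value `≤ 28` (`stppExprBound2`,
kernel).  (2) TRANSFER (`stppCheck_map_cast_zmod2`, the two-coordinate copy of `stppCheck_map_intCast_zmod` of
`STPP222CubeCyclic.lean`): for `n > 28` a reduced expression vanishing in `ℤ/n × ℤ/n` has both integer coordinates
divisible by `n` and bounded by `28 < n`, hence zero, and the integer clause applies.  (3) The twelve… eighteen pairs
`{v, −v}` stay 2-element sets mod `n` because some coordinate of `2v` is non-zero of absolute value `≤ 20 < n`
(`pairGapCheck2`).  (4) For `25 ≤ n ≤ 28` the SAME configuration reduced mod `n` passes `stppCheck` by kernel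
evaluation in `ZMod n × ZMod n` (`stppCheck_rot6_small`).  Desk cross-checks (Python, literal Def. 5.1): the reduced
family passes for every `n` with `25 ≤ n ≤ 200` and for `n = 10007`; it FAILS for `n = 20, 22, 24` (and passes for
`n = 19, 21, 23`, not claimed here), so `25` is the right uniform start for this configuration; the complete searches
found SOME family of this rotation type for every `n = 11, …, 40` and NONE for `n = 7, …, 10` (seat records HOME
`pub-omega-stpp-3-g17/results/halforbit/`).  No minimality claim of any kind.

References: H. Cohn, R. Kleinberg, B. Szegedy, C. Umans, FOCS 2005 (arXiv:math/0511460), Def. 5.1.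
Seat pub-omega-stpp-3 (gen 17), 2026-08-26.
-/

open Literature.Computability.AlgebraicComplexity Finset

namespace Summit.MatrixMultiplication.OmegaCensus

namespace Rot6

/-- The integer configuration, `A`-pairs: `ρ^i {±(0,1)}` twice (`i = 0,1,2` for each base triple). -/
def rot6A : Fin 6 → List (ℤ × ℤ) :=
  ![[(0, 1), (0, -1)], [(-1, -1), (1, 1)], [(1, 0), (-1, 0)],
    [(0, 1), (0, -1)], [(-1, -1), (1, 1)], [(1, 0), (-1, 0)]]

/-- The integer configuration, `B`-pairs: `ρ^i {±(0,2)}` and `ρ^i {±(0,3)}`. -/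
def rot6B : Fin 6 → List (ℤ × ℤ) :=
  ![[(0, 2), (0, -2)], [(-2, -2), (2, 2)], [(2, 0), (-2, 0)],
    [(0, 3), (0, -3)], [(-3, -3), (3, 3)], [(3, 0), (-3, 0)]]

/-- The integer configuration, `C`-pairs: `ρ^i {±(0,4)}` and `ρ^i {±(1,10)}`. -/
def rot6C : Fin 6 → List (ℤ × ℤ) :=
  ![[(0, 4), (0, -4)], [(-4, -4), (4, 4)], [(4, 0), (-4, 0)],
    [(1, 10), (-1, -10)], [(-10, -9), (10, 9)], [(9, -1), (-9, 1)]]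

/-- Boolean check (two-coordinate form of `stppExprBound`): EVERY constraint expression
`(s′ − s) + (t′ − t) + (u′ − u)` of CKSU Def. 5.1 (same nine quantifiers as `stppCheck`) of an integer configuration in
`ℤ × ℤ` has both coordinates of absolute value `≤ M`. [cite: CohnKleinbergSzegedyUmans2005, Def. 5.1] -/
def stppExprBound2 {N : ℕ} (LA LB LC : Fin N → List (ℤ × ℤ)) (M : ℕ) : Bool :=
  (List.finRange N).all fun i => (List.finRange N).all fun j => (List.finRange N).all fun k =>
    (LA k).all fun s => (LA i).all fun s' => (LB i).all fun t => (LB j).all fun t' =>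
      (LC j).all fun u => (LC k).all fun u' =>
        decide (((s' - s) + (t' - t) + (u' - u)).1.natAbs ≤ M ∧ ((s' - s) + (t' - t) + (u' - u)).2.natAbs ≤ M)

/-- Boolean check that every list of the configuration is a pair `[v, w]` with, in SOME coordinate, `v ≠ w` at
distance `≤ G` (so that `v` and `w` stay distinct modulo every `n > G`). -/
def pairGapCheck2 {N : ℕ} (L : Fin N → List (ℤ × ℤ)) (G : ℕ) : Bool :=
  (List.finRange N).all fun i =>
    match L i with
    | [v, w] => decide ((v.1 ≠ w.1 ∧ (v.1 - w.1).natAbs ≤ G) ∨ (v.2 ≠ w.2 ∧ (v.2 - w.2).natAbs ≤ G))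
    | _ => false

/-- The reduction map `ℤ × ℤ → ℤ/n × ℤ/n`. -/
def castZ2 (n : ℕ) (p : ℤ × ℤ) : ZMod n × ZMod n := ((p.1 : ZMod n), (p.2 : ZMod n))

/-- The integer configuration satisfies CKSU Def. 5.1 in `ℤ × ℤ` (kernel evaluation of `stppCheck`, 13 824 words).
[cite: CohnKleinbergSzegedyUmans2005, Def. 5.1] -/
theorem stppCheck_rot6_int : stppCheck rot6A rot6B rot6C = true := by
  decide +kernel

/-- Every constraint expression of the integer configuration has both coordinates of absolute value `≤ 28`
(kernel evaluation; `28` is attained). -/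
theorem stppExprBound2_rot6 : stppExprBound2 rot6A rot6B rot6C 28 = true := by
  decide +kernel

/-- The eighteen pairs `{v, −v}` of the configuration differ, in some coordinate, by a non-zero integer of absolute
value `≤ 20` (kernel evaluation). -/
theorem pairGapCheck2_rot6 :
    pairGapCheck2 rot6A 20 = true ∧ pairGapCheck2 rot6B 20 = true ∧ pairGapCheck2 rot6C 20 = true := by
  refine ⟨?_, ?_, ?_⟩ <;> decide +kernel

/-- **Transfer lemma (`ℤ × ℤ → ℤ/n × ℤ/n`).** If integer lists pass `stppCheck` in `ℤ × ℤ` and all their constraint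
expressions have both coordinates bounded by `M` in absolute value, then for every `n > M` the lists reduced by `castZ2 n`
pass `stppCheck` in `ZMod n × ZMod n`: a vanishing reduced expression has both integer coordinates divisible by `n` and
of absolute value `≤ M < n`, hence equal to `0`, and the integer clause applies. -/
theorem stppCheck_map_cast_zmod2 {N : ℕ} {LA LB LC : Fin N → List (ℤ × ℤ)} {M : ℕ}
    (hS : stppCheck LA LB LC = true) (hB : stppExprBound2 LA LB LC M = true) {n : ℕ} (hn : M < n) :
    stppCheck (fun i => (LA i).map (castZ2 n)) (fun i => (LB i).map (castZ2 n))
      (fun i => (LC i).map (castZ2 n)) = true := by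
  haveI : NeZero n := ⟨by omega⟩
  simp only [stppCheck, stppExprBound2, List.all_eq_true, decide_eq_true_eq, List.forall_mem_map] at hS hB ⊢
  intro i hi j hj k hk s hs s' hs' t ht t' ht' u hu u' hu' h0
  have hb := hB i hi j hj k hk s hs s' hs' t ht t' ht' u hu u' hu'
  set E : ℤ × ℤ := (s' - s) + (t' - t) + (u' - u) with hEdef
  have h1 : ((E.1 : ℤ) : ZMod n) = 0 := by
    have := congrArg Prod.fst h0
    simpa [castZ2, hEdef] using this
  have h2 : ((E.2 : ℤ) : ZMod n) = 0 := by
    have := congrArg Prod.snd h0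
    simpa [castZ2, hEdef] using this
  rw [ZMod.intCast_zmod_eq_zero_iff_dvd] at h1 h2
  have hz1 : E.1 = 0 := by
    apply Int.eq_zero_of_dvd_of_natAbs_lt_natAbs h1
    simp only [Int.natAbs_natCast]
    omega
  have hz2 : E.2 = 0 := by
    apply Int.eq_zero_of_dvd_of_natAbs_lt_natAbs h2
    simp only [Int.natAbs_natCast]
    omega
  have hz : (s' - s) + (t' - t) + (u' - u) = 0 := by
    rw [← hEdef]; exact Prod.ext hz1 hz2
  obtain ⟨hij, hjk, hss, htt, huu⟩ := hS i hi j hj k hk s hs s' hs' t ht t' ht' u hu u' hu' hz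
  exact ⟨hij, hjk, by rw [hss], by rw [htt], by rw [huu]⟩

/-- A two-element integer-pair list `[v, w]` whose entries differ in some coordinate by a non-zero integer of absolute
value `< n` reduces by `castZ2 n` to a finset of cardinality `2`. -/
theorem card_toFinset_map_pair2 {n : ℕ} {v w : ℤ × ℤ}
    (h : (v.1 ≠ w.1 ∧ (v.1 - w.1).natAbs < n) ∨ (v.2 ≠ w.2 ∧ (v.2 - w.2).natAbs < n)) :
    (([v, w].map (castZ2 n)).toFinset).card = 2 := by
  have hne : castZ2 n v ≠ castZ2 n w := by
    intro hvw
    rcases h with ⟨hneq, hlt⟩ | ⟨hneq, hlt⟩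
    · have h1 : ((v.1 : ℤ) : ZMod n) = ((w.1 : ℤ) : ZMod n) := by
        have := congrArg Prod.fst hvw; simpa [castZ2] using this
      rw [ZMod.intCast_eq_intCast_iff_dvd_sub] at h1
      have h0 := Int.eq_zero_of_dvd_of_natAbs_lt_natAbs h1 (by
        simp only [Int.natAbs_natCast]; rw [← Int.natAbs_neg]; simpa using hlt)
      omega
    · have h2 : ((v.2 : ℤ) : ZMod n) = ((w.2 : ℤ) : ZMod n) := by
        have := congrArg Prod.snd hvw; simpa [castZ2] using this
      rw [ZMod.intCast_eq_intCast_iff_dvd_sub] at h2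
      have h0 := Int.eq_zero_of_dvd_of_natAbs_lt_natAbs h2 (by
        simp only [Int.natAbs_natCast]; rw [← Int.natAbs_neg]; simpa using hlt)
      omega
  simp only [List.map_cons, List.map_nil, List.toFinset_cons, List.toFinset_nil, Finset.insert_empty]
  exact card_pair hne

/-- If `pairGapCheck2 L G` accepts the lists then, modulo any `n > G`, each reduced list is a finset of cardinality `2`. -/
theorem card_of_pairGapCheck2 {N : ℕ} {L : Fin N → List (ℤ × ℤ)} {G : ℕ} (h : pairGapCheck2 L G = true) {n : ℕ}
    (hn : G < n) (i : Fin N) : (((L i).map (castZ2 n)).toFinset).card = 2 := by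
  simp only [pairGapCheck2, List.all_eq_true, List.mem_finRange, forall_const] at h
  have hi := h i
  split at hi
  · rename_i v w hL
    rw [hL]
    simp only [decide_eq_true_eq] at hi
    apply card_toFinset_map_pair2
    rcases hi with ⟨hneq, hle⟩ | ⟨hneq, hle⟩
    · exact Or.inl ⟨hneq, by omega⟩
    · exact Or.inr ⟨hneq, by omega⟩
  · exact absurd hi (by simp)

/-- For every modulus `n ≥ 29` the integer configuration reduced by `castZ2 n` passes `stppCheck` in `ℤ/n × ℤ/n`. -/
theorem stppCheck_rot6_zmod {n : ℕ} (hn : 29 ≤ n) :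
    stppCheck (fun i => (rot6A i).map (castZ2 n)) (fun i => (rot6B i).map (castZ2 n))
      (fun i => (rot6C i).map (castZ2 n)) = true :=
  stppCheck_map_cast_zmod2 stppCheck_rot6_int stppExprBound2_rot6 (by omega)

/-- For the four small moduli `25 ≤ n ≤ 28` the SAME configuration reduced mod `n` passes `stppCheck` in
`ℤ/n × ℤ/n` (kernel evaluation, four moduli). [cite: CohnKleinbergSzegedyUmans2005, Def. 5.1] -/
theorem stppCheck_rot6_small : ∀ n ∈ Finset.Icc 25 28,
    stppCheck (fun i => (rot6A i).map (castZ2 n)) (fun i => (rot6B i).map (castZ2 n))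
      (fun i => (rot6C i).map (castZ2 n)) = true := by
  decide +kernel

end Rot6

open Rot6 in
/-- **The rotation family: `ℤ/n × ℤ/n` admits the STPP pattern `(2,2,2)⁶` for every `n ≥ 25`.**  There are six triples
`(Aᵢ, Bᵢ, Cᵢ)` of 2-element subsets of `ZMod n × ZMod n` satisfying the simultaneous triple product property (CKSU 2005
Def. 5.1, tree form `IsSTPP`): the reductions mod `n` of the integer configuration `rot6A/B/C` = the `C₆ = ⟨−1, ρ⟩`
half-orbits of the symmetric triples `({±(0,1)},{±(0,2)},{±(0,4)})` and `({±(0,1)},{±(0,3)},{±(1,10)})`,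
`ρ = [[0,−1],[1,−1]]`.  Proof: transfer lemma for `n ≥ 29` (expression bound `28`), kernel evaluation for `25 ≤ n ≤ 28`,
pair gaps `≤ 20`.  Census STRUCTURE entry (pre-registration P-036.3); no threshold moves and no `ω` bound follows.
[cite: CohnKleinbergSzegedyUmans2005, Def. 5.1] -/
theorem exists_isSTPP_222pow6_zmod_sq (n : ℕ) (hn : 25 ≤ n) :
    ∃ A B C : Fin 6 → Finset (ZMod n × ZMod n),
      IsSTPP A B C ∧ ∀ i, (A i).card = 2 ∧ (B i).card = 2 ∧ (C i).card = 2 := by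
  have hc : ∀ i, (((rot6A i).map (castZ2 n)).toFinset).card = 2 ∧ (((rot6B i).map (castZ2 n)).toFinset).card = 2 ∧
      (((rot6C i).map (castZ2 n)).toFinset).card = 2 := fun i =>
    ⟨card_of_pairGapCheck2 pairGapCheck2_rot6.1 (by omega) i, card_of_pairGapCheck2 pairGapCheck2_rot6.2.1 (by omega) i,
      card_of_pairGapCheck2 pairGapCheck2_rot6.2.2 (by omega) i⟩
  by_cases h29 : 29 ≤ n
  · exact exists_isSTPP_222pow_of_lists _ _ _ (stppCheck_rot6_zmod h29) hc
  · have hmem : n ∈ Finset.Icc 25 28 := by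
      rw [Finset.mem_Icc]; omega
    exact exists_isSTPP_222pow_of_lists _ _ _ (stppCheck_rot6_small n hmem) hc

end Summit.MatrixMultiplication.OmegaCensus
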